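/-
Copyright: statement-level skeleton of a published paper (lit-balaban cell, Phase-2 proof seat p13, gen 9). No proof
claims beyond what the kernel checks below.
-/
import Literature.MathematicalPhysics.QuantumFieldTheory.BalabanImbrieJaffe1984to88.BIJ88F1Localized290
import Literature.MathematicalPhysics.QuantumFieldTheory.BalabanImbrieJaffe1984to88.BIJ88Ineq576Proof

/-!
# `BalabanImbrieJaffe1984to88.BIJ88F2Localized290` — T. Bałaban, J. Imbrie, A. Jaffe, *Effective action and cluster
properties of the abelian Higgs model*, Commun. Math. Phys. **114** (1988) 257–315 [BalabanImbrieJaffe1988]: Sect. 5.7,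
p. 290 — the second display preceding (5.7.7) **with its sum over regions `X` and the printed kernel bound**:
*"In a similar fashion we can write (F_{2,j}(Ã̃^ζ,u_{k+1})φ)(y) = Σ_{x∈B_j(y)} ζ^du_{k+1}(Γ^{(j)}_{y,x})φ(x) × Σ_{n=1}^{n̄}
(ie_jζÃ̃(Γ^{(j)}_{y,x}))ⁿ/n! + Σ_X (F_{2,j}(X)φ)(y), with |F_{2,j}(X; y, x)| ≦ ζ^de_j^{n̄+1−α}e^{−cr(e_k)|X|⁻}"*, and the `ℤ^d`
MODEL INSTANCE of the first display's remainder bound *"|F_{1,j,b}(X)| ≦ e_j^{n̄+1−α}e^{−cr(e_k)|X|⁻}"* with (5.7.6) DISCHARGED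
by p36's `BIJ88Ineq576Proof.ineq576_Zd` (file 1b of seat p13 gen 9 towards (5.7.7); 1a = `BIJ88F1Localized290`).

statement-level skeleton of published theorems with citation tags; proofs where landed; nothing here is a claim about the Yang–Mills mass gap

PDF held: `paper:balaban1988-cmp114-bij-abelian-higgs-effective-action` (journal page = PDF page + 256); pp. 287–290
[PDF 31–34] read as IMAGES (CCITT renders `pages/original-p031-x2.png` …; copies `HOME/lit-balaban-p13/pages/`).

CITATION HEADER (lean-in-tree rule).  Part of the lit-balaban TYPED SKELETON (HOME `run/shared/lean/pub/lit-balaban/`):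
WHAT IS REPRODUCED = row **C2.Eq5.7.7-5.7.9** of `HOME/lit-balaban-r16/ROWS-C2-part2.md`, member *(5.7.7), the second p. 290
expansion display* (typed by p02's `BIJ88F1Taylor290.F2_split` without the `X`-localization) and the `ℤ^d` instance of the
first.  Unit `lit-balaban-p13` (gen 9), owner r16, referee ref-5.  Built BY NAME on file 1a (`LocDatum.locRem`,
`sum_locRem_eq_remF1`, `norm_locRem_le`, `norm_F1loc_le_printed`, `f1_display`), r16's `BIJ88Sect5StatementsPart4.F2`, p02's
`taylorF2`/`remF2`/`F2_split`, p36's `BIJ88Assoc575Zd.assocZd` and `BIJ88Ineq576Proof.ineq576_Zd`; nothing restated.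

## What is kernel-checked here

* **`F2loc`** `(F_{2,j}(X)φ)(y) := Σ_{x∈B_j(y)} ζ^du_{k+1}(Γ_{y,x})φ(x)·locRem_{(y,x)}(X)` (one `LocDatum` per pair `(y,x)`: the
  exponent of (5.6.8) is `ie_jζÃ̃(Γ^{(j)}_{y,x})`), **`f2_display`** — THE SECOND DISPLAY with its `Σ_X` for r16's `F2`,
  **`norm_F2ker_le_printed`** — *"|F_{2,j}(X; y, x)| ≦ ζ^de_j^{n̄+1−α}e^{−cr(e_k)|X|⁻}"* for unimodular transporters under the inputs
  of file 1a at the pair `(y,x)`.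
* THE `ℤ^d` MODEL INSTANCE: `stairHull` (the finite set of cubes all regions live in), `assocZd_mem_powerset`,
  `card_assocZd_zero` (the empty collection sits on ONE cube), `datumZd`; **`f1_display_Zd`** (no hypothesis) and
  **`norm_F1loc_le_Zd`** — the printed bound for EVERY `X ⊆ ℤ^d` with p36's rate `c′ = min(c₁/4, c₃/(2d))`, hypotheses = the two
  displayed on p. 290 (`|A′(b_l)| ≤ a`, `|w₅(b,b_l)| ≤ e^{−c₁ℓ}e^{−c₂dist(b,b_l)}`), `r(e_k)` large, `|a_loc| ≤ p` and the field regime.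

HONEST SCOPE as in file 1a (model level; transporters, kernels, fields are inputs in the displayed shapes).  Definitions with
bodies (`F2loc`, `stairHull`, `datumZd`) + theorems; no `Prop` facts; axioms standard.
-/

noncomputable section

open scoped BigOperators
open Complex Finset

namespace Literature.MathematicalPhysics.QuantumFieldTheory.BalabanImbrieJaffe1984to88.BIJ88F2Localized290

open BIJ88Sect5Statements (F1)
open BIJ88Sect5StatementsPart2 (PolymerSys Ineq576)
open BIJ88Sect5StatementsPart4 (F2)
open BIJ88F1Taylor290 (taylorF2 remF2 F2_split)
open BIJ88F1Localized290 (wloc LocDatum)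

/-! ## §1 Inside the covariant block average: `F_{2,j}(X; y, x)` and the second display -/

section F2

variable {α γ β Poly : Type*} [Fintype β] [DecidableEq Poly]

/-- **`(F_{2,j}(X)φ)(y) := Σ_{x∈B_j(y)} ζ^d u_{k+1}(Γ_{y,x})φ(x)·locRem_{(y,x)}(X)`** — the localized high-order part of the
covariant block average; its kernel `F_{2,j}(X; y, x) = ζ^d u_{k+1}(Γ_{y,x})·locRem_{(y,x)}(X)` (one `LocDatum` per pair: the
exponent of (5.6.8) is `ie_jζÃ̃(Γ^{(j)}_{y,x})`). [cite: BalabanImbrieJaffe1988, (5.7.7) p.290] -/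
def F2loc (B : γ → Finset α) (w : ℝ) (U : γ → α → ℂ) (D : γ → α → LocDatum β Poly) (ej ζ : ℝ) (nbar : ℕ) (X : Poly)
    (φ : α → ℂ) (y : γ) : ℂ :=
  ∑ x ∈ B y, (w : ℂ) * U y x * φ x * (D y x).locRem ej ζ nbar X

/-- **p. 290, THE SECOND DISPLAY WITH ITS SUM OVER REGIONS**, verbatim: *"(F_{2,j}(Ã̃^ζ, u_{k+1})φ)(y) = Σ_{x∈B_j(y)}
ζ^du_{k+1}(Γ^{(j)}_{y,x})φ(x) × Σ_{n=1}^{n̄} (ie_jζÃ̃(Γ^{(j)}_{y,x}))ⁿ/n! + Σ_X (F_{2,j}(X)φ)(y)"* — PROVED for r16's `F2` with the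
exponents `ie_jζÃ̃(Γ_{y,x})`, `Ã̃(Γ_{y,x}) = (D y x).total`, p02's `taylorF2` and the constructed `F2loc`.
[cite: BalabanImbrieJaffe1988, (5.7.7) p.290] -/
theorem f2_display (B : γ → Finset α) (w : ℝ) (U : γ → α → ℂ) (D : γ → α → LocDatum β Poly) (Xs : Finset Poly)
    (hXs : ∀ y x m t, (D y x).assoc m t ∈ Xs) (ej ζ : ℝ) (nbar : ℕ) (φ : α → ℂ) (y : γ) :
    F2 B w U (fun y x => I * (ej * ζ * (D y x).total : ℝ)) φ y =
      taylorF2 B w U (fun y x => I * (ej * ζ * (D y x).total : ℝ)) nbar φ y +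
        ∑ X ∈ Xs, F2loc B w U D ej ζ nbar X φ y := by
  rw [F2_split _ _ _ _ nbar]
  congr 1
  unfold remF2 F2loc
  rw [Finset.sum_comm]
  refine Finset.sum_congr rfl fun x _ => ?_
  rw [← Finset.mul_sum, (D y x).sum_locRem_eq_remF1 Xs (hXs y x) ej ζ nbar]

/-- **p. 290, THE PRINTED KERNEL BOUND** *"with |F_{2,j}(X; y, x)| ≦ ζ^d e_j^{n̄+1−α}e^{−cr(e_k)|X|⁻}"*: for unimodular
transporters (`‖u(Γ)‖ = 1`), weight `w = ζ^d ≥ 0`, and at the pair `(y,x)` the inputs of `norm_F1loc_le_printed` with the field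
regime `ζ^{n̄+1}(p+1)^{n̄+1}e^{e_jζ(p+1)}/(n̄+1)! ≤ e_j^{−α}`. [cite: BalabanImbrieJaffe1988, (5.7.7) p.290] -/
theorem norm_F2ker_le_printed (P : PolymerSys) [DecidableEq P.Poly] {w : ℝ} (hw : 0 ≤ w) {U : γ → α → ℂ}
    (hU : ∀ y x, ‖U y x‖ = 1) (D : γ → α → LocDatum β P.Poly) {ej ζ p c rk α' : ℝ} (hej : 0 < ej) (hζ : 0 < ζ)
    (hc : 0 ≤ c * rk) (y : γ) (x : α) (hp : |(D y x).aloc| ≤ p)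
    (h576 : ∀ m, 1 ≤ m → Ineq576 P (wloc (D y x).wr (D y x).A' m ((D y x).assoc m)) c rk)
    (h0 : ∀ t : Fin 0 → β, P.card ((D y x).assoc 0 t) ≤ 1) {nbar : ℕ}
    (hfield : ζ ^ (nbar + 1) * (p + 1) ^ (nbar + 1) * Real.exp (ej * ζ * (p + 1)) / ((nbar + 1).factorial : ℝ) ≤
      ej ^ (-α'))
    (X : P.Poly) :
    ‖(w : ℂ) * U y x * (D y x).locRem ej ζ nbar X‖ ≤
      w * (ej ^ ((nbar : ℝ) + 1 - α') * Real.exp (-(c * rk) * P.cardMinus X)) := by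
  have h576' : ∀ m, 1 ≤ m → ∀ X, |wloc (D y x).wr (D y x).A' m ((D y x).assoc m) X| ≤
      (1 : ℝ) ^ m * Real.exp (-(c * rk) * P.card X) :=
    fun m hm X => by rw [one_pow, one_mul]; exact h576 m hm X
  have h := (D y x).norm_locRem_le P hp zero_le_one hc h576' h0 ej ζ nbar X
  rw [abs_of_nonneg (mul_nonneg hej.le hζ.le)] at h
  rw [norm_mul, norm_mul, hU, mul_one, Complex.norm_real, Real.norm_eq_abs, abs_of_nonneg hw]
  refine mul_le_mul_of_nonneg_left (h.trans ?_) hw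
  have hrw : ej ^ ((nbar : ℝ) + 1 - α') = ej ^ (nbar + 1) * ej ^ (-α') := by
    rw [show (nbar : ℝ) + 1 - α' = ((nbar + 1 : ℕ) : ℝ) + (-α') by push_cast; ring, Real.rpow_add hej,
      Real.rpow_natCast]
  rw [hrw]
  have hE : 0 ≤ Real.exp (-(c * rk) * P.cardMinus X) := (Real.exp_pos _).le
  calc (ej * ζ * (p + 1)) ^ (nbar + 1) / ((nbar + 1).factorial : ℝ) * Real.exp (ej * ζ * (p + 1)) *
          Real.exp (-(c * rk) * P.cardMinus X)
      = ej ^ (nbar + 1) * (ζ ^ (nbar + 1) * (p + 1) ^ (nbar + 1) * Real.exp (ej * ζ * (p + 1)) /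
          ((nbar + 1).factorial : ℝ)) * Real.exp (-(c * rk) * P.cardMinus X) := by rw [mul_pow, mul_pow]; ring
    _ ≤ ej ^ (nbar + 1) * ej ^ (-α') * Real.exp (-(c * rk) * P.cardMinus X) :=
        mul_le_mul_of_nonneg_right (mul_le_mul_of_nonneg_left hfield (pow_nonneg hej.le _)) hE

end F2

/-! ## §2 The `ℤ^d` model instance: (5.7.6) discharged by p36's `ineq576_Zd` -/

section Zd

open BIJ88WalkGeometryZd BIJ88Assoc575Zd BIJ88Ineq576Proof

variable {dd : ℕ} {β : Type*}

/-- the empty collection is associated to the single cube of `b`: `|assocZd pos ℓ b 0 t| = 1`.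
[cite: BalabanImbrieJaffe1988, (5.7.5) p.289] -/
theorem card_assocZd_zero (pos : β → Fin dd → ℤ) (ℓ : ℕ) (b : β) (t : Fin 0 → β) : (assocZd pos ℓ b 0 t).card = 1 := by
  unfold assocZd
  simp

/-- the `LocDatum` of the `ℤ^d` model at the bond `b`: local part `a_loc`, row `w₅(b,·)`, field `A′`, p36's association.
[cite: BalabanImbrieJaffe1988, (5.7.5) p.289] -/
def datumZd (pos : β → Fin dd → ℤ) (ℓ : ℕ) (aloc : ℝ) (w₅ : β → β → ℝ) (A' : β → ℝ) (b : β) :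
    LocDatum β (Finset (Fin dd → ℤ)) :=
  ⟨aloc, w₅ b, A', fun m => assocZd pos ℓ b m⟩

variable [Fintype β]

/-- every region the `ℤ^d` association produces lies in the finite STAIR HULL of `b`: the cube of `b` and the staircases to all
bond cubes (finite volume ⇒ finitely many regions `X`). [cite: BalabanImbrieJaffe1988, (5.7.5) p.289] -/
def stairHull (pos : β → Fin dd → ℤ) (ℓ : ℕ) (b : β) : Finset (Fin dd → ℤ) :=
  insert (cubeIdx ℓ (pos b)) (Finset.univ.biUnion fun b' => stair (cubeIdx ℓ (pos b)) (cubeIdx ℓ (pos b')))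

/-- `assocZd pos ℓ b m t ⊆ stairHull pos ℓ b`, i.e. the association ranges in the powerset of the stair hull.
[cite: BalabanImbrieJaffe1988, (5.7.5) p.289] -/
theorem assocZd_mem_powerset (pos : β → Fin dd → ℤ) (ℓ : ℕ) (b : β) (m : ℕ) (t : Fin m → β) :
    assocZd pos ℓ b m t ∈ (stairHull pos ℓ b).powerset := by
  rw [Finset.mem_powerset]
  intro q hq
  unfold assocZd at hq
  unfold stairHull
  rcases Finset.mem_insert.mp hq with h | h
  · exact Finset.mem_insert.mpr (Or.inl h)
  · obtain ⟨l, -, hl⟩ := Finset.mem_biUnion.mp h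
    exact Finset.mem_insert_of_mem (Finset.mem_biUnion.mpr ⟨t l, Finset.mem_univ _, hl⟩)

/-- **THE FIRST DISPLAY on `ℤ^d`**: `ζ^{−1}F₁(ie_jζÃ̃_b) = Σ_{n=1}^{n̄} ζ^{−1}(ie_jζÃ̃_b)ⁿ/n! + Σ_{X ⊆ stairHull b} F_{1,j,b}(X)` with
`Ã̃_b = a_loc + Σ_{b′} w₅(b,b′)A′(b′)`, no hypothesis. [cite: BalabanImbrieJaffe1988, (5.7.7) p.290] -/
theorem f1_display_Zd (pos : β → Fin dd → ℤ) (ℓ : ℕ) (aloc : ℝ) (w₅ : β → β → ℝ) (A' : β → ℝ) (b : β) (ej ζ : ℝ)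
    (nbar : ℕ) :
    (ζ : ℂ)⁻¹ * F1 (I * (ej * ζ * (aloc + ∑ b', w₅ b b' * A' b') : ℝ)) =
      (∑ n ∈ range nbar, (ζ : ℂ)⁻¹ * (I * (ej * ζ * (aloc + ∑ b', w₅ b b' * A' b') : ℝ)) ^ (n + 1) / (n + 1).factorial) +
        ∑ X ∈ (stairHull pos ℓ b).powerset, (datumZd pos ℓ aloc w₅ A' b).F1loc ej ζ nbar X :=
  (datumZd pos ℓ aloc w₅ A' b).f1_display _ (fun m t => assocZd_mem_powerset pos ℓ b m t) ej ζ nbar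

/-- **THE PRINTED REMAINDER BOUND on `ℤ^d`, (5.7.6) DISCHARGED** (p36's `ineq576_Zd`): bonds placed in `ℤ^d` by `pos` with at
most `N` per site, `r(e_k)`-cubes of side `ℓ ≥ 1`, the two displayed kernel hypotheses of p. 290 `|w₅(b,b′)| ≤
e^{−c₁ℓ}e^{−c₂·dist(b,b′)}`, `|A′(b′)| ≤ a`, `r(e_k)` large (`a·N(1+4d/c₃)^d ≤ e^{c₁ℓ/4}`, `c₃ = min(c₁/2,c₂)`), the field bound
`|a_loc| ≤ p` and the field regime; conclusion `‖F_{1,j,b}(X)‖ ≤ e_j^{n̄+1−α}e^{−c′ℓ|X|⁻}` for EVERY `X`, with p36's rate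
`c′ = min(c₁/4, c₃/(2d))`. [cite: BalabanImbrieJaffe1988, (5.7.7) p.290] -/
theorem norm_F1loc_le_Zd [DecidableEq β] (hd : 0 < dd) (pos : β → Fin dd → ℤ) (N : ℕ)
    (hN : ∀ y, (Finset.univ.filter fun b' => pos b' = y).card ≤ N) {ℓ : ℕ} (hℓ : 0 < ℓ) (aloc : ℝ) (w₅ : β → β → ℝ)
    (A' : β → ℝ) (b : β) {c₁ c₂ a p ej ζ α : ℝ} (hc₁ : 0 < c₁) (hc₂ : 0 < c₂)
    (hw : ∀ b', |w₅ b b'| ≤ Real.exp (-(c₁ * ℓ)) * Real.exp (-(c₂ * supDist (pos b) (pos b'))))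
    (hA : ∀ b', |A' b'| ≤ a) (hlarge : a * (N * (1 + 4 * dd / min (c₁ / 2) c₂) ^ dd) ≤ Real.exp (c₁ * ℓ / 4))
    (hej : 0 < ej) (hζ : 0 < ζ) (hp : |aloc| ≤ p) {nbar : ℕ}
    (hfield : ζ ^ nbar * (p + 1) ^ (nbar + 1) * Real.exp (ej * ζ * (p + 1)) / ((nbar + 1).factorial : ℝ) ≤ ej ^ (-α))
    (X : Finset (Fin dd → ℤ)) :
    ‖(datumZd pos ℓ aloc w₅ A' b).F1loc ej ζ nbar X‖ ≤
      ej ^ ((nbar : ℝ) + 1 - α) *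
        Real.exp (-(min (c₁ / 4) (min (c₁ / 2) c₂ / (2 * dd)) * ℓ) * PolymerSys.cardMinus ⟨_, Finset.card⟩ X) := by
  have hc' : 0 ≤ min (c₁ / 4) (min (c₁ / 2) c₂ / (2 * dd)) * ℓ := by
    have : 0 < min (c₁ / 4) (min (c₁ / 2) c₂ / (2 * dd)) :=
      lt_min (by linarith) (div_pos (lt_min (by linarith) hc₂) (by positivity))
    positivity
  refine (datumZd pos ℓ aloc w₅ A' b).norm_F1loc_le_printed ⟨_, Finset.card⟩ hej hζ hp hc' (fun m hm => ?_)
    (fun t => (card_assocZd_zero pos ℓ b t).le) hfield X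
  exact ineq576_Zd hd pos N hN hℓ w₅ A' b hm hc₁ hc₂ hw hA hlarge

end Zd

end Literature.MathematicalPhysics.QuantumFieldTheory.BalabanImbrieJaffe1984to88.BIJ88F2Localized290

end
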